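import Literature.Analysis.FunctionSpaces.BMOWeightedL2
import Literature.Analysis.FunctionSpaces.WeakCompactnessLpFinite
import Mathlib.Analysis.SpecialFunctions.JapaneseBracket
import HarnessLib

/-!
# Weak sequential compactness of bounded sequences in `BMO` modulo constants

Analysis/FunctionSpaces **proofs file** (theorems only: no definitions, no named facts, no
`sorry`). For a finite-dimensional real inner product space `E`:

* `exists_subseq_tendsto_integral_mul_of_eBMOSeminorm_le` — **a bounded sequence in `BMO(E)`
  has, modulo constants, a weakly convergent subsequence**: if `f_n ∈ BMO` with `‖f_n‖_* ≤ K`,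
  then along some `σ` the normalised functions `f_{σ(n)} − (f_{σ(n)})_{B(0,1)}` converge
  against every bounded measurable `φ` vanishing off a ball, `∫ (f_{σ(n)} − c_n) φ → ∫ g φ`, to a
  measurable locally integrable `g ∈ BMO` with `‖g‖_* ≤ 2K`;
  `…_continuous_…` is the same against continuous compactly supported `φ`;
* `eBMOSeminorm_le_two_mul_of_tendsto_integral_mul` — the seminorm bound of such a limit
  (for a ball `B`, `∫_B |g − g_B| = ∫ g ψ` with the mean-zero multiplier
  `ψ = 𝟙_B (sign(g − g_B) − a)`, `|ψ| ≤ 2`, and `∫ (f_n − c_n) ψ ≤ 2 ‖f_n‖_* |B|`).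

Route (no duality `BMO = (H¹)*` needed): by `BMOWeightedL2` the normalised functions are bounded
in `L²(μ)`, `μ = (1 + |z|)^{-(d+2)} dz`, a finite measure; the tree's weak sequential compactness
in `L²` of a finite measure (`exists_subseq_tendsto_integral_mul_of_lintegral_rpow_le'`,
`WeakCompactnessLpFinite`, through Dunford–Pettis) extracts the subsequence and the limit; the
multiplier `φ / w ∈ L^∞ ⊂ L²(μ)` converts `μ`-pairings into Lebesgue pairings
(`integral_withDensity_eq_integral_toReal_smul`); local integrability of the limit for `dz`
follows from `w ≥ c_S > 0` on bounded sets. The classical statement (Fefferman–Stein: bounded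
sequences in `BMO` have weak-* convergent subsequences with `‖g‖_* ≤ lim inf ‖f_n‖_*`) is
sharper by the factor `2`, which is irrelevant for the intended use: carrying a uniform
`L^∞_t BMO_x` bound on the stream functions of a blow-up sequence to the blow-up limit
(Lei–Zhang 2011, proof of Thm. 1.4, arXiv:1011.5066 p. 12: "the stream function … is scaling
invariant. Thus the stream function of `u` is in BMO").

## Mathlib / tree search

Reused: `exists_lintegral_enorm_sub_average_sq_mul_weight_le` (`BMOWeightedL2`),
`exists_subseq_tendsto_integral_mul_of_lintegral_rpow_le'` (`WeakCompactnessLpFinite`),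
`MemBMO.setIntegral_norm_sub_average_le`, `MemBMO.integrableOn_ball` (`BMOCarlesonProofs`);
Mathlib `finite_integral_one_add_norm`, `isFiniteMeasure_withDensity`,
`lintegral_withDensity_eq_lintegral_mul_non_measurable`, `restrict_withDensity`,
`integral_withDensity_eq_integral_toReal_smul`, `withDensity_absolutelyContinuous`,
`Measure.integrableOn_of_bounded`, `norm_setIntegral_le_of_norm_le_const`.
`lean search 'BMO.*(subseq|weak|compact)'`: nothing prior for `BMO` (the tree has weak
compactness in `L¹`, `L^p` of finite measures, `L³(ℝ³)`, Besov and tempered weak-* versions).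

## References

* C. Fefferman, E. M. Stein, *`H^p` spaces of several variables*, Acta Math. 129 (1972), §2
  (duality `H¹`–`BMO`). [FeffermanStein1972]
* H. Brezis, *Functional Analysis, Sobolev Spaces and PDE* (2011), Thm. 3.18. [Brezis2011]
* Z. Lei, Q. S. Zhang, J. Funct. Anal. 261 (2011) = arXiv:1011.5066, proof of Thm. 1.4 (p. 12).
  [LeiZhang2011]
-/

noncomputable section

open MeasureTheory Set Function Filter Metric
open _root_.Topology
open scoped NNReal ENNReal

namespace Literature.Analysis.FunctionSpaces

universe u

variable {E : Type u} [NormedAddCommGroup E] [InnerProductSpace ℝ E] [FiniteDimensional ℝ E]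
  [MeasurableSpace E] [BorelSpace E]

/-! ### Lower semicontinuity of the `BMO` seminorm under weak convergence modulo constants -/

/-- **The `BMO` seminorm of a weak limit modulo constants.** Let `f_n ∈ BMO(E)` with
`‖f_n‖_* ≤ K`, constants `c_n`, and a measurable locally integrable `g` such that
`∫ (f_n − c_n) ψ → ∫ g ψ` for every bounded measurable `ψ` vanishing off a ball. Then
`‖g‖_* ≤ 2K`: for a ball `B`, `∫_B |g − g_B| = ∫ g ψ` for the mean-zero function
`ψ = 𝟙_B (sign(g − g_B) − a)`, `a` the average of the sign over `B`, `|ψ| ≤ 2`, and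
`∫ (f_n − c_n) ψ = ∫_B (f_n − (f_n)_B) ψ ≤ 2 ‖f_n‖_* |B|` (the factor `2` is the price of centring
at the ball average instead of the optimal constant). [folklore] -/
theorem eBMOSeminorm_le_two_mul_of_tendsto_integral_mul {f : ℕ → E → ℝ} {c : ℕ → ℝ} {g : E → ℝ}
    {K : ℝ≥0} (hf : ∀ n, MemBMO (f n)) (hK : ∀ n, eBMOSeminorm (f n) ≤ K)
    (hgm : Measurable g) (hg : LocallyIntegrable g)
    (hlim : ∀ ψ : E → ℝ, Measurable ψ → (∃ M : ℝ, ∀ z, |ψ z| ≤ M) →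
      (∃ (y : E) (r : ℝ), ∀ z, z ∉ ball y r → ψ z = 0) →
      Tendsto (fun n => ∫ z, (f n z - c n) * ψ z) atTop (𝓝 (∫ z, g z * ψ z))) :
    eBMOSeminorm g ≤ 2 * K := by
  refine iSup_le fun y => iSup₂_le fun r hr => ?_
  set B : Set E := ball y r with hB
  have hBm : MeasurableSet B := measurableSet_ball
  have hB0 : volume B ≠ 0 := (measure_ball_pos volume y hr).ne'
  have hBt : volume B ≠ ∞ := measure_ball_lt_top.ne
  have hBt' : volume B < ∞ := measure_ball_lt_top
  set V : ℝ := volume.real B with hV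
  have hVpos : 0 < V := ENNReal.toReal_pos hB0 hBt
  set m : ℝ := ⨍ z in B, g z with hm
  have hgi : IntegrableOn g B := (hg.integrableOn_isCompact (isCompact_closedBall y r)).mono_set
    ball_subset_closedBall
  -- the sign of `g - m`, its average `a` over `B`, and the mean-zero test function `ψ`
  set s : E → ℝ := fun z => if m ≤ g z then 1 else -1 with hs
  have hsm : Measurable s := Measurable.ite (measurableSet_le measurable_const hgm)
    measurable_const measurable_const
  have hs1 : ∀ z, |s z| ≤ 1 := fun z => by
    simp only [hs]; split_ifs <;> simp
  have hsi : IntegrableOn s B := Measure.integrableOn_of_bounded hBt hsm.aestronglyMeasurable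
    (ae_of_all _ fun z => by rw [Real.norm_eq_abs]; exact hs1 z)
  set a : ℝ := ⨍ z in B, s z with ha
  have hBs : ∫ z in B, s z = a * V := by
    rw [ha, setAverage_eq, smul_eq_mul, ← hV, inv_mul_eq_div, div_mul_cancel₀ _ hVpos.ne']
  have ha1 : |a| ≤ 1 := by
    have h1 : ‖∫ z in B, s z‖ ≤ 1 * V :=
      norm_setIntegral_le_of_norm_le_const hBt' fun z _ => by rw [Real.norm_eq_abs]; exact hs1 z
    rw [Real.norm_eq_abs, hBs, abs_mul, abs_of_pos hVpos] at h1
    exact le_of_mul_le_mul_right h1 hVpos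
  set ψ : E → ℝ := B.indicator fun z => s z - a with hψ
  have hψm : Measurable ψ := (hsm.sub measurable_const).indicator hBm
  have hψ2 : ∀ z, |ψ z| ≤ 2 := fun z => by
    by_cases hz : z ∈ B
    · rw [hψ, Set.indicator_of_mem hz]
      calc |s z - a| ≤ |s z| + |a| := abs_sub _ _
        _ ≤ 1 + 1 := add_le_add (hs1 z) ha1
        _ = 2 := by norm_num
    · rw [hψ, Set.indicator_of_notMem hz]; simp
  have hψ0 : ∀ z, z ∉ ball y r → ψ z = 0 := fun z hz =>
    Set.indicator_of_notMem (s := B) hz _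
  have hψmean : ∫ z in B, (s z - a) = 0 := by
    rw [integral_sub hsi (integrableOn_const hBt), hBs, setIntegral_const, smul_eq_mul, ← hV]
    ring
  -- Step 1: `∫ g ψ = ∫_B |g - m|`
  have hbd1 : ∀ z, ‖s z - a‖ ≤ 2 := fun z => by
    rw [Real.norm_eq_abs]
    calc |s z - a| ≤ |s z| + |a| := abs_sub _ _
      _ ≤ 1 + 1 := add_le_add (hs1 z) ha1
      _ = 2 := by norm_num
  have hgs : IntegrableOn (fun z => g z * (s z - a)) B :=
    hgi.mul_bdd (hsm.sub measurable_const).aestronglyMeasurable (ae_of_all _ hbd1)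
  have hgs' : IntegrableOn (fun z => g z * s z) B :=
    hgi.mul_bdd hsm.aestronglyMeasurable (ae_of_all _ fun z => by
      rw [Real.norm_eq_abs]; exact hs1 z)
  have hBg : ∫ z in B, g z = m * V := by
    rw [hm, setAverage_eq, smul_eq_mul, ← hV, inv_mul_eq_div, div_mul_cancel₀ _ hVpos.ne']
  have hlhs : ∫ z, g z * ψ z = (∫ z in B, g z * s z) - a * (m * V) := by
    have h1 : (fun z => g z * ψ z) = B.indicator fun z => g z * (s z - a) := by
      funext z; simp only [hψ, Set.indicator_mul_right]
    rw [h1, integral_indicator hBm]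
    have h2 : ∀ z, g z * (s z - a) = g z * s z - a * g z := fun z => by ring
    simp_rw [h2]
    rw [integral_sub hgs' (hgi.const_mul a), integral_const_mul, hBg]
  have habs : ∀ z, |g z - m| = (g z - m) * s z := fun z => by
    simp only [hs]
    split_ifs with h
    · rw [mul_one, abs_of_nonneg (sub_nonneg.2 h)]
    · rw [mul_neg, mul_one, abs_of_neg (sub_neg.2 (not_le.1 h))]
  have hrhs : ∫ z in B, |g z - m| = (∫ z in B, g z * s z) - m * (a * V) := by
    simp_rw [habs]
    have h2 : ∀ z, (g z - m) * s z = g z * s z - m * s z := fun z => by ring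
    simp_rw [h2]
    rw [integral_sub hgs' (hsi.const_mul m), integral_const_mul, hBs]
  have hkey : ∫ z in B, |g z - m| = ∫ z, g z * ψ z := by rw [hlhs, hrhs]; ring
  -- Step 2: `∫ (f n - c n) ψ ≤ 2 K V` for every `n`
  have hbound : ∀ n, ∫ z, (f n z - c n) * ψ z ≤ 2 * K * V := by
    intro n
    set mn : ℝ := ⨍ z in B, f n z with hmn
    have hfi : IntegrableOn (f n) B := (hf n).integrableOn_ball y r
    have h1 : (fun z => (f n z - c n) * ψ z) = B.indicator fun z => (f n z - c n) * (s z - a) := by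
      funext z; simp only [hψ, Set.indicator_mul_right]
    rw [h1, integral_indicator hBm]
    have h2 : ∀ z, (f n z - c n) * (s z - a) = (f n z - mn) * (s z - a) + (mn - c n) * (s z - a) :=
      fun z => by ring
    simp_rw [h2]
    have hi1 : IntegrableOn (fun z => (f n z - mn) * (s z - a)) B :=
      (hfi.sub (integrableOn_const hBt)).mul_bdd (hsm.sub measurable_const).aestronglyMeasurable
        (ae_of_all _ hbd1)
    have hi2 : IntegrableOn (fun z => (mn - c n) * (s z - a)) B :=
      (hsi.sub (integrableOn_const hBt)).const_mul _
    rw [integral_add hi1 hi2, integral_const_mul, hψmean, mul_zero, add_zero]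
    calc ∫ z in B, (f n z - mn) * (s z - a) ≤ ∫ z in B, ‖f n z - mn‖ * 2 := by
          refine integral_mono hi1 ((hfi.sub (integrableOn_const hBt)).norm.mul_const 2)
            fun z => ?_
          calc (f n z - mn) * (s z - a) ≤ |(f n z - mn) * (s z - a)| := le_abs_self _
            _ = ‖f n z - mn‖ * |s z - a| := by rw [abs_mul, Real.norm_eq_abs]
            _ ≤ ‖f n z - mn‖ * 2 := by
                gcongr; simpa [Real.norm_eq_abs] using hbd1 z
      _ = (∫ z in B, ‖f n z - mn‖) * 2 := integral_mul_const _ _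
      _ ≤ (K * V) * 2 := by
          gcongr
          have h3 := (hf n).setIntegral_norm_sub_average_le y hr
          have h4 : (eBMOSeminorm (f n)).toReal ≤ K := by
            have := ENNReal.toReal_mono ENNReal.coe_ne_top (hK n)
            simpa using this
          exact h3.trans (mul_le_mul_of_nonneg_right h4 measureReal_nonneg)
      _ = 2 * K * V := by ring
  -- Step 3: pass to the limit
  have hle : ∫ z in B, |g z - m| ≤ 2 * K * V := by
    rw [hkey]
    exact le_of_tendsto' (hlim ψ hψm ⟨2, hψ2⟩ ⟨y, r, hψ0⟩) hbound
  -- Step 4: the `ℝ≥0∞`-valued average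
  have hint : Integrable (fun z => g z - m) (volume.restrict B) :=
    hgi.sub (integrableOn_const hBt)
  rw [setLAverage_eq, ENNReal.div_le_iff hB0 hBt,
    ← ofReal_integral_norm_eq_lintegral_enorm hint]
  simp only [Real.norm_eq_abs]
  calc ENNReal.ofReal (∫ z in B, |g z - m|) ≤ ENNReal.ofReal (2 * K * V) :=
        ENNReal.ofReal_le_ofReal hle
    _ = 2 * K * volume B := by
        rw [hV, measureReal_def, ENNReal.ofReal_mul (by positivity), ENNReal.ofReal_toReal hBt,
          ENNReal.ofReal_mul (by positivity), ENNReal.ofReal_ofNat, ENNReal.ofReal_coe_nnreal]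

/-! ### Extraction -/

/-- **Weak sequential compactness of bounded sequences in `BMO` modulo constants.** Let
`f_n ∈ BMO(E)` with `‖f_n‖_* ≤ K`. Then along a subsequence `σ` the normalised functions
`f_{σ(n)} − (f_{σ(n)})_{B(0,1)}` converge weakly — against every bounded measurable function
vanishing off a ball — to a measurable, locally integrable `g ∈ BMO(E)` with `‖g‖_* ≤ 2K`.
Proof: by `exists_lintegral_enorm_sub_average_sq_mul_weight_le` the normalised functions are
bounded in the Hilbert space `L²(μ)`, `μ = (1 + |z|)^{-(d+2)} dz` a finite measure, where the
tree's weak sequential compactness (`exists_subseq_tendsto_integral_mul_of_lintegral_rpow_le'`,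
Dunford–Pettis route) extracts a weakly convergent subsequence; a bounded `φ` vanishing off a
ball gives the `L²(μ)` multiplier `φ / w`, and `∫ h (φ/w) dμ = ∫ h φ dz`; the seminorm of the
limit is bounded by `eBMOSeminorm_le_two_mul_of_tendsto_integral_mul`. (`BMO` is the dual of the
Hardy space `H¹`, so bounded sequences even have weak-* convergent subsequences with
`‖g‖_* ≤ lim inf ‖f_n‖_*`, Fefferman–Stein; the elementary Hilbert-space route costs the factor
`2` and needs no duality.) [folklore] -/
theorem exists_subseq_tendsto_integral_mul_of_eBMOSeminorm_le {f : ℕ → E → ℝ}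
    (hf : ∀ n, MemBMO (f n)) {K : ℝ≥0} (hK : ∀ n, eBMOSeminorm (f n) ≤ K) :
    ∃ σ : ℕ → ℕ, StrictMono σ ∧ ∃ g : E → ℝ, Measurable g ∧ MemBMO g ∧
      eBMOSeminorm g ≤ 2 * K ∧
      ∀ φ : E → ℝ, Measurable φ → (∃ M : ℝ, ∀ z, |φ z| ≤ M) →
        (∃ (y : E) (r : ℝ), ∀ z, z ∉ ball y r → φ z = 0) →
        Tendsto (fun n => ∫ z, (f (σ n) z - ⨍ w in ball 0 1, f (σ n) w) * φ z) atTop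
          (𝓝 (∫ z, g z * φ z)) := by
  set d : ℕ := Module.finrank ℝ E with hd
  -- the weight and the weighted (finite) measure
  set w : E → ℝ := fun z => ((1 + ‖z‖) ^ (d + 2))⁻¹ with hw
  have hw_pos : ∀ z, 0 < w z := fun z => by simp only [hw]; positivity
  have hw_cont : Continuous w := by
    simp only [hw]
    exact Continuous.inv₀ (by fun_prop) fun z => by positivity
  have hw_meas : Measurable w := hw_cont.measurable
  set ρ : E → ℝ≥0∞ := fun z => ENNReal.ofReal (w z) with hρ
  have hρ_meas : Measurable ρ := hw_meas.ennreal_ofReal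
  have hρ_top : ∀ z, ρ z < ∞ := fun z => ENNReal.ofReal_lt_top
  set μ : Measure E := volume.withDensity ρ with hμ
  have hμ_fin : IsFiniteMeasure μ := by
    refine isFiniteMeasure_withDensity ?_
    have h := finite_integral_one_add_norm (μ := (volume : Measure E)) (r := ((d + 2 : ℕ) : ℝ))
      (by rw [← hd]; exact_mod_cast (by omega : d < d + 2))
    refine ne_of_lt (lt_of_le_of_lt (le_of_eq (lintegral_congr fun z => ?_)) h)
    simp only [hρ, hw]
    rw [Real.rpow_neg (by positivity), Real.rpow_natCast]
  have hac : μ ≪ volume := withDensity_absolutelyContinuous _ _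
  -- the normalised functions are bounded in `L²(μ)`
  obtain ⟨C, hC⟩ := exists_lintegral_enorm_sub_average_sq_mul_weight_le (E := E)
  set h : ℕ → E → ℝ := fun n z => f n z - ⨍ w in ball 0 1, f n w with hh
  have hh_meas : ∀ n, AEStronglyMeasurable (h n) μ := fun n =>
    ((hf n).1.aestronglyMeasurable.sub aestronglyMeasurable_const).mono_ac hac
  have hbd : ∀ n, ∫⁻ z, ‖h n z‖ₑ ^ (2 : ℝ) ∂μ ≤ ENNReal.ofReal (C * K ^ 2) := by
    intro n
    have h1 : ∫⁻ z, ‖h n z‖ₑ ^ (2 : ℝ) ∂μ = ∫⁻ z, ‖h n z‖ₑ ^ 2 * ρ z := by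
      rw [hμ, lintegral_withDensity_eq_lintegral_mul_non_measurable _ hρ_meas
        (Eventually.of_forall hρ_top)]
      refine lintegral_congr fun z => ?_
      rw [Pi.mul_apply, mul_comm]
      norm_cast
    rw [h1]
    have h2 := hC (f n) (hf n) 0
    simp only [sub_zero] at h2
    refine h2.trans (ENNReal.ofReal_le_ofReal ?_)
    have h3 : (eBMOSeminorm (f n)).toReal ≤ K := by
      have := ENNReal.toReal_mono ENNReal.coe_ne_top (hK n)
      simpa using this
    gcongr
  -- weak extraction in `L²(μ)`
  obtain ⟨σ, hσ, g₀, hg₀, -, hweak⟩ :=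
    exists_subseq_tendsto_integral_mul_of_lintegral_rpow_le' (μ := μ) Real.HolderConjugate.two_two
      hh_meas ENNReal.ofReal_ne_top hbd
  -- a measurable representative
  set g : E → ℝ := hg₀.1.mk with hgdef
  have hg_sm : StronglyMeasurable g := hg₀.1.stronglyMeasurable_mk
  have hgm : Measurable g := hg_sm.measurable
  have hg_ae : g₀ =ᵐ[μ] g := hg₀.1.ae_eq_mk
  have hgL2 : MemLp g (ENNReal.ofReal 2) μ := hg₀.ae_eq hg_ae
  have hgμ : Integrable g μ := hgL2.integrable (by simp)
  -- the pairing identity `∫ F (φ/w) dμ = ∫ F φ dz`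
  have hpair : ∀ (F φ : E → ℝ), ∫ z, F z * (φ z * (w z)⁻¹) ∂μ = ∫ z, F z * φ z := by
    intro F φ
    rw [hμ, integral_withDensity_eq_integral_toReal_smul hρ_meas (Eventually.of_forall hρ_top)]
    refine integral_congr_ae (Eventually.of_forall fun z => ?_)
    simp only [hρ, smul_eq_mul, ENNReal.toReal_ofReal (hw_pos z).le]
    field_simp [(hw_pos z).ne']
  -- multipliers: a bounded `φ` vanishing off a ball gives `φ / w ∈ L²(μ)`
  have hmult : ∀ φ : E → ℝ, Measurable φ → (∃ M : ℝ, ∀ z, |φ z| ≤ M) →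
      (∃ (y : E) (r : ℝ), ∀ z, z ∉ ball y r → φ z = 0) →
      MemLp (fun z => φ z * (w z)⁻¹) (ENNReal.ofReal 2) μ := by
    rintro φ hφm ⟨M, hM⟩ ⟨y, r, hyr⟩
    have hbdd : ∀ z, ‖φ z * (w z)⁻¹‖ ≤ |M| * (1 + (‖y‖ + |r|)) ^ (d + 2) := by
      intro z
      by_cases hz : z ∈ ball y r
      · rw [norm_mul, Real.norm_eq_abs, Real.norm_eq_abs, abs_inv, abs_of_pos (hw_pos z), hw,
          inv_inv]
        have hz' : ‖z‖ ≤ ‖y‖ + |r| := by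
          have h1 : ‖z - y‖ < r := mem_ball_iff_norm.1 hz
          calc ‖z‖ = ‖(z - y) + y‖ := by rw [sub_add_cancel]
            _ ≤ ‖z - y‖ + ‖y‖ := norm_add_le _ _
            _ ≤ ‖y‖ + |r| := by linarith [le_abs_self r]
        refine mul_le_mul ((hM z).trans (le_abs_self M)) ?_ (by positivity) (abs_nonneg M)
        exact pow_le_pow_left₀ (by positivity) (by linarith) _
      · rw [hyr z hz, zero_mul, norm_zero]; positivity
    exact (memLp_top_of_bound (hφm.mul hw_meas.inv).aestronglyMeasurable _
      (Eventually.of_forall hbdd)).mono_exponent le_top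
  -- the weak convergence against bounded compactly supported multipliers, w.r.t. `dz`
  have hlim : ∀ φ : E → ℝ, Measurable φ → (∃ M : ℝ, ∀ z, |φ z| ≤ M) →
      (∃ (y : E) (r : ℝ), ∀ z, z ∉ ball y r → φ z = 0) →
      Tendsto (fun n => ∫ z, h (σ n) z * φ z) atTop (𝓝 (∫ z, g z * φ z)) := by
    intro φ hφm hM hyr
    have h1 := hweak _ (hmult φ hφm hM hyr)
    have h2 : ∫ z, g₀ z * (φ z * (w z)⁻¹) ∂μ = ∫ z, g z * (φ z * (w z)⁻¹) ∂μ :=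
      integral_congr_ae (by filter_upwards [hg_ae] with z hz; rw [hz])
    rw [h2, hpair] at h1
    simpa only [hpair] using h1
  -- local integrability of `g` w.r.t. `dz`
  have hgloc : LocallyIntegrable g := by
    intro x
    refine ⟨closedBall x 1, closedBall_mem_nhds x one_pos, ?_⟩
    set S : Set E := closedBall x 1 with hS
    have hSm : MeasurableSet S := measurableSet_closedBall
    set cS : ℝ := ((1 + (‖x‖ + 1)) ^ (d + 2))⁻¹ with hcS
    have hcS_pos : 0 < cS := by positivity
    have hwS : ∀ z ∈ S, cS ≤ w z := by
      intro z hz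
      simp only [hw, hcS]
      have hz' : ‖z‖ ≤ ‖x‖ + 1 := by
        have h1 : ‖z - x‖ ≤ 1 := mem_closedBall_iff_norm.1 hz
        calc ‖z‖ = ‖(z - x) + x‖ := by rw [sub_add_cancel]
          _ ≤ ‖z - x‖ + ‖x‖ := norm_add_le _ _
          _ ≤ ‖x‖ + 1 := by linarith
      gcongr
    refine ⟨hgm.aestronglyMeasurable, ?_⟩
    -- `∫⁻_S ‖g‖ₑ ≤ cS⁻¹ ∫⁻ ‖g‖ₑ dμ < ∞`
    have h1 : ∫⁻ z in S, ‖g z‖ₑ ≤ ∫⁻ z in S, ρ z * ‖g z‖ₑ * (ENNReal.ofReal cS)⁻¹ := by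
      refine setLIntegral_mono' hSm fun z hz => ?_
      have hρz : ENNReal.ofReal cS ≤ ρ z := ENNReal.ofReal_le_ofReal (hwS z hz)
      have hc0 : ENNReal.ofReal cS ≠ 0 := (ENNReal.ofReal_pos.2 hcS_pos).ne'
      calc ‖g z‖ₑ = ENNReal.ofReal cS * ‖g z‖ₑ * (ENNReal.ofReal cS)⁻¹ := by
            rw [mul_comm (ENNReal.ofReal cS), mul_assoc,
              ENNReal.mul_inv_cancel hc0 ENNReal.ofReal_ne_top, mul_one]
        _ ≤ ρ z * ‖g z‖ₑ * (ENNReal.ofReal cS)⁻¹ := by gcongr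
    have h2 : ∫⁻ z in S, ρ z * ‖g z‖ₑ * (ENNReal.ofReal cS)⁻¹ =
        (∫⁻ z in S, ‖g z‖ₑ ∂μ) * (ENNReal.ofReal cS)⁻¹ := by
      rw [lintegral_mul_const' _ _ (ENNReal.inv_ne_top.2 (ENNReal.ofReal_pos.2 hcS_pos).ne'), hμ,
        restrict_withDensity hSm,
        lintegral_withDensity_eq_lintegral_mul_non_measurable _ hρ_meas
          (Eventually.of_forall fun z => hρ_top z)]
      rfl
    calc ∫⁻ z in S, ‖g z‖ₑ ≤ (∫⁻ z in S, ‖g z‖ₑ ∂μ) * (ENNReal.ofReal cS)⁻¹ := h1.trans_eq h2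
      _ ≤ (∫⁻ z, ‖g z‖ₑ ∂μ) * (ENNReal.ofReal cS)⁻¹ := by
          gcongr; exact Measure.restrict_le_self
      _ < ∞ := ENNReal.mul_lt_top hgμ.2
          (ENNReal.inv_lt_top.2 (ENNReal.ofReal_pos.2 hcS_pos))
  -- the seminorm of the limit
  have hbmo : eBMOSeminorm g ≤ 2 * K :=
    eBMOSeminorm_le_two_mul_of_tendsto_integral_mul (f := fun n => f (σ n))
      (c := fun n => ⨍ w in ball 0 1, f (σ n) w) (fun n => hf (σ n)) (fun n => hK (σ n))
      hgm hgloc hlim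
  refine ⟨σ, hσ, g, hgm, ⟨hgloc, hbmo.trans_lt (by simp [ENNReal.mul_lt_top])⟩, hbmo, ?_⟩
  exact hlim

/-- **Weak sequential compactness of `BMO` modulo constants, against continuous compactly
supported test functions** (the form in which distributional identities — e.g. `curl B = v` for
stream functions — pass to the limit). [folklore] -/
theorem exists_subseq_tendsto_integral_mul_continuous_of_eBMOSeminorm_le {f : ℕ → E → ℝ}
    (hf : ∀ n, MemBMO (f n)) {K : ℝ≥0} (hK : ∀ n, eBMOSeminorm (f n) ≤ K) :
    ∃ σ : ℕ → ℕ, StrictMono σ ∧ ∃ g : E → ℝ, Measurable g ∧ MemBMO g ∧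
      eBMOSeminorm g ≤ 2 * K ∧
      ∀ φ : E → ℝ, Continuous φ → HasCompactSupport φ →
        Tendsto (fun n => ∫ z, (f (σ n) z - ⨍ w in ball 0 1, f (σ n) w) * φ z) atTop
          (𝓝 (∫ z, g z * φ z)) := by
  obtain ⟨σ, hσ, g, hgm, hg, hbmo, hlim⟩ :=
    exists_subseq_tendsto_integral_mul_of_eBMOSeminorm_le hf hK
  refine ⟨σ, hσ, g, hgm, hg, hbmo, fun φ hφ hφc => ?_⟩
  obtain ⟨M, hM⟩ := hφ.bounded_above_of_compact_support hφc
  obtain ⟨R, -, hR⟩ := hφc.exists_pos_le_norm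
  refine hlim φ hφ.measurable ⟨M, fun z => by simpa [Real.norm_eq_abs] using hM z⟩
    ⟨0, R, fun z hz => hR z ?_⟩
  simpa [mem_ball_iff_norm, not_lt] using hz

end Literature.Analysis.FunctionSpaces
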